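import Literature.Probability.Percolation.KohlerSchindlerTassionRSW
import Literature.Probability.Percolation.CornerPercolation
import Summits.CriticalPhenomena.CardyFormulaZ2.Theorems.CardySelfRefinementCriticalPathRSWStubCone3GraphA

/-!
# Stub `stub_cone3` of line `finite-size-envelope` (crux `CriticalPathRSW`), part 2b:
surgery along short walks and the bridge to `KST2023.crossing`

Support file for item `stmt-CriticalPhenomena-10267` (stub `stub_cone3`).  Continuation of
`…StubCone3GraphA` (same local notations `nbr⟪B, U, a⟫`, `clus⟪B, U, a⟫`, `side⟪B, U, L⟫`,
`joined⟪B, L, R⟫` for the set-builder expressions of label-level connectivity inside a box `B`):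

* **surgery along a walk** (`Cone3.surgery₁` … `Cone3.surgery₄`): if `L ↮ R`, `p₀ ↔ L`,
  `p_k ↔ R` and `p₀, …, p_k` (`k ≤ 4`) are the consecutive ends of labels `ℓ₁, …, ℓ_k` inside `B`,
  then for some `i < k`, after opening `ℓ₁, …, ℓ_i` the sides are still disconnected and opening
  moreover `ℓ_{i+1}` connects them (so `ℓ_{i+1}` becomes pivotal);
* the bridge `Cone3.edgeConfig_mem_crossing_iff` to the tree's event `KST2023.crossing m n`
  (`openCrossing` of the box between its left and right sides) for configurations `edgeConfig U`.

Everything is folklore graph theory (Grimmett 1999, §1.3, §2.4).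
-/

noncomputable section

namespace Summit.CriticalPhenomena.CardyFormulaZ2.Cruxes.CriticalPathRSW.FiniteSizeEnvelope

open Set
open Literature.Probability.LatticeModels Literature.Probability.Percolation

namespace Cone3

/-! ### Local notations

(`quotPrecheck` is switched off for them: Mathlib's set-builder syntax has no precheck handler.) -/

set_option quotPrecheck false

/-- Neighbours of `a` through an open label of `U`, inside `B`. -/
local notation "nbr⟪" B ", " U ", " a "⟫" =>
  {b : Site 2 | a ∈ B ∧ b ∈ B ∧ ∃ d : Fin 2,
    (b = a + Pi.single d 1 ∧ (a, d) ∈ U) ∨ (a = b + Pi.single d 1 ∧ (b, d) ∈ U)}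

/-- The open cluster of `a` inside `B`. -/
local notation "clus⟪" B ", " U ", " a "⟫" =>
  {b : Site 2 | Relation.ReflTransGen (fun x y : Site 2 => y ∈ nbr⟪B, U, x⟫) a b}

/-- The vertices joined inside `B` to the side `L`. -/
local notation "side⟪" B ", " U ", " L "⟫" => {v : Site 2 | ∃ a ∈ L, v ∈ clus⟪B, U, a⟫}

/-- The label configurations joining `L` to `R` inside `B`. -/
local notation "joined⟪" B ", " L ", " R "⟫" =>
  {U : Set (Site 2 × Fin 2) | ∃ a ∈ L, ∃ b ∈ R, b ∈ clus⟪B, U, a⟫}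

/-- The labels with both ends in `B`. -/
local notation "labIn⟪" B "⟫" => {ℓ : Site 2 × Fin 2 | ℓ.1 ∈ B ∧ ℓ.1 + Pi.single ℓ.2 1 ∈ B}

/-! ### Surgery along short walks -/

/-- **Surgery, one label.** If `L ↮ R`, `p₀ ↔ L`, `ℓ₁` joins `p₀` to `p₁` and `p₁ ↔ R`, then
opening `ℓ₁` connects the sides. -/
theorem surgery₁ {B : Set (Site 2)} {U : Set (Site 2 × Fin 2)} {L R : Set (Site 2)} {ℓ₁ : Site 2 × Fin 2}
    {p₀ p₁ : Site 2} (h₁ : p₁ ∈ nbr⟪B, ({ℓ₁} : Set (Site 2 × Fin 2)), p₀⟫)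
    (hp : p₀ ∈ side⟪B, U, L⟫) (hq : p₁ ∈ side⟪B, U, R⟫) : U ∪ {ℓ₁} ∈ joined⟪B, L, R⟫ :=
  joined_of_side (side_step (side_mono Set.subset_union_left L hp) (nbr_mono Set.subset_union_right h₁))
    (side_mono Set.subset_union_left R hq)

/-- **Surgery, two labels.** -/
theorem surgery₂ {B : Set (Site 2)} {U : Set (Site 2 × Fin 2)} {L R : Set (Site 2)}
    {ℓ₁ ℓ₂ : Site 2 × Fin 2} {p₀ p₁ p₂ : Site 2}
    (h₁ : p₁ ∈ nbr⟪B, ({ℓ₁} : Set (Site 2 × Fin 2)), p₀⟫) (h₂ : p₂ ∈ nbr⟪B, ({ℓ₂} : Set (Site 2 × Fin 2)), p₁⟫)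
    (hno : U ∉ joined⟪B, L, R⟫) (hp : p₀ ∈ side⟪B, U, L⟫) (hq : p₂ ∈ side⟪B, U, R⟫) :
    (U ∉ joined⟪B, L, R⟫ ∧ U ∪ {ℓ₁} ∈ joined⟪B, L, R⟫) ∨
      (U ∪ {ℓ₁} ∉ joined⟪B, L, R⟫ ∧ U ∪ {ℓ₁} ∪ {ℓ₂} ∈ joined⟪B, L, R⟫) := by
  by_cases h : p₁ ∈ side⟪B, U, R⟫
  · exact Or.inl ⟨hno, surgery₁ h₁ hp h⟩
  · obtain ⟨hno', hp'⟩ := one_step h₁ hno hp h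
    exact Or.inr ⟨hno', surgery₁ h₂ hp' (side_mono Set.subset_union_left R hq)⟩

/-- **Surgery, three labels.** -/
theorem surgery₃ {B : Set (Site 2)} {U : Set (Site 2 × Fin 2)} {L R : Set (Site 2)}
    {ℓ₁ ℓ₂ ℓ₃ : Site 2 × Fin 2} {p₀ p₁ p₂ p₃ : Site 2}
    (h₁ : p₁ ∈ nbr⟪B, ({ℓ₁} : Set (Site 2 × Fin 2)), p₀⟫) (h₂ : p₂ ∈ nbr⟪B, ({ℓ₂} : Set (Site 2 × Fin 2)), p₁⟫)
    (h₃ : p₃ ∈ nbr⟪B, ({ℓ₃} : Set (Site 2 × Fin 2)), p₂⟫)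
    (hno : U ∉ joined⟪B, L, R⟫) (hp : p₀ ∈ side⟪B, U, L⟫) (hq : p₃ ∈ side⟪B, U, R⟫) :
    (U ∉ joined⟪B, L, R⟫ ∧ U ∪ {ℓ₁} ∈ joined⟪B, L, R⟫) ∨
      (U ∪ {ℓ₁} ∉ joined⟪B, L, R⟫ ∧ U ∪ {ℓ₁} ∪ {ℓ₂} ∈ joined⟪B, L, R⟫) ∨
      (U ∪ {ℓ₁} ∪ {ℓ₂} ∉ joined⟪B, L, R⟫ ∧ U ∪ {ℓ₁} ∪ {ℓ₂} ∪ {ℓ₃} ∈ joined⟪B, L, R⟫) := by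
  by_cases h : p₁ ∈ side⟪B, U, R⟫
  · exact Or.inl ⟨hno, surgery₁ h₁ hp h⟩
  · obtain ⟨hno', hp'⟩ := one_step h₁ hno hp h
    exact Or.inr (surgery₂ h₂ h₃ hno' hp' (side_mono Set.subset_union_left R hq))

/-- **Surgery, four labels.** -/
theorem surgery₄ {B : Set (Site 2)} {U : Set (Site 2 × Fin 2)} {L R : Set (Site 2)}
    {ℓ₁ ℓ₂ ℓ₃ ℓ₄ : Site 2 × Fin 2} {p₀ p₁ p₂ p₃ p₄ : Site 2}
    (h₁ : p₁ ∈ nbr⟪B, ({ℓ₁} : Set (Site 2 × Fin 2)), p₀⟫) (h₂ : p₂ ∈ nbr⟪B, ({ℓ₂} : Set (Site 2 × Fin 2)), p₁⟫)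
    (h₃ : p₃ ∈ nbr⟪B, ({ℓ₃} : Set (Site 2 × Fin 2)), p₂⟫) (h₄ : p₄ ∈ nbr⟪B, ({ℓ₄} : Set (Site 2 × Fin 2)), p₃⟫)
    (hno : U ∉ joined⟪B, L, R⟫) (hp : p₀ ∈ side⟪B, U, L⟫) (hq : p₄ ∈ side⟪B, U, R⟫) :
    (U ∉ joined⟪B, L, R⟫ ∧ U ∪ {ℓ₁} ∈ joined⟪B, L, R⟫) ∨
      (U ∪ {ℓ₁} ∉ joined⟪B, L, R⟫ ∧ U ∪ {ℓ₁} ∪ {ℓ₂} ∈ joined⟪B, L, R⟫) ∨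
      (U ∪ {ℓ₁} ∪ {ℓ₂} ∉ joined⟪B, L, R⟫ ∧ U ∪ {ℓ₁} ∪ {ℓ₂} ∪ {ℓ₃} ∈ joined⟪B, L, R⟫) ∨
      (U ∪ {ℓ₁} ∪ {ℓ₂} ∪ {ℓ₃} ∉ joined⟪B, L, R⟫ ∧
        U ∪ {ℓ₁} ∪ {ℓ₂} ∪ {ℓ₃} ∪ {ℓ₄} ∈ joined⟪B, L, R⟫) := by
  by_cases h : p₁ ∈ side⟪B, U, R⟫
  · exact Or.inl ⟨hno, surgery₁ h₁ hp h⟩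
  · obtain ⟨hno', hp'⟩ := one_step h₁ hno hp h
    exact Or.inr (surgery₃ h₂ h₃ h₄ hno' hp' (side_mono Set.subset_union_left R hq))

/-! ### The bridge to `KST2023.crossing` -/

/-- Adjacency in the open graph of `edgeConfig U`: the two vertices are the ends of an open label. -/
theorem openGraph_edgeConfig_adj_iff (U : Set (Site 2 × Fin 2)) (a b : Site 2) :
    (openGraph (edgeConfig U)).Adj a b ↔
      ∃ d : Fin 2, (b = a + Pi.single d 1 ∧ (a, d) ∈ U) ∨ (a = b + Pi.single d 1 ∧ (b, d) ∈ U) := by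
  rw [openGraph_adj, edgeConfig_eq_image, Set.mem_image]
  constructor
  · rintro ⟨⟨⟨v, d⟩, hvU, hve⟩, -⟩
    simp only [cornerEdge] at hve
    rcases Sym2.eq_iff.1 hve with ⟨h1, h2⟩ | ⟨h1, h2⟩
    · subst h1
      exact ⟨d, Or.inl ⟨h2.symm, hvU⟩⟩
    · subst h1
      exact ⟨d, Or.inr ⟨h2.symm, hvU⟩⟩
  · rintro ⟨d, ⟨h1, h2⟩ | ⟨h1, h2⟩⟩
    · subst h1
      exact ⟨⟨(a, d), h2, rfl⟩, (add_single_ne a d).symm⟩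
    · subst h1
      exact ⟨⟨(b, d), h2, Sym2.eq_swap⟩, add_single_ne b d⟩

/-- **Bridge**: for a configuration `edgeConfig U`, the tree's restricted connection event
`openConnIn B x y` is the label-level connection `y ∈ clus⟪B, U, x⟫` (with `x, y ∈ B`). -/
theorem edgeConfig_mem_openConnIn_iff (U : Set (Site 2 × Fin 2)) (B : Set (Site 2)) (x y : Site 2) :
    edgeConfig U ∈ openConnIn B x y ↔ x ∈ B ∧ y ∈ B ∧ y ∈ clus⟪B, U, x⟫ := by
  constructor
  · rintro ⟨hx, hy, hr⟩
    refine ⟨hx, hy, ?_⟩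
    rw [SimpleGraph.reachable_iff_reflTransGen] at hr
    suffices key : ∀ z : B, Relation.ReflTransGen ((openGraph (edgeConfig U)).induce B).Adj ⟨x, hx⟩ z →
        (z : Site 2) ∈ clus⟪B, U, x⟫ from key ⟨y, hy⟩ hr
    intro z hz
    induction hz with
    | refl => exact mem_clus_self _
    | tail _ hbc ih =>
      rw [SimpleGraph.induce_adj, openGraph_edgeConfig_adj_iff] at hbc
      exact clus_step ih ⟨Subtype.prop _, Subtype.prop _, hbc⟩
  · rintro ⟨hx, hy, h⟩
    suffices key : ∀ z, z ∈ clus⟪B, U, x⟫ → ∃ hz : z ∈ B,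
        ((openGraph (edgeConfig U)).induce B).Reachable ⟨x, hx⟩ ⟨z, hz⟩ by
      obtain ⟨hy', hr⟩ := key y h
      exact ⟨hx, hy', hr⟩
    intro z hz
    induction hz with
    | refl => exact ⟨hx, SimpleGraph.Reachable.refl _⟩
    | tail _ hbc ih =>
      obtain ⟨hb, hr⟩ := ih
      refine ⟨hbc.2.1, hr.trans (SimpleGraph.Adj.reachable ?_)⟩
      rw [SimpleGraph.induce_adj, openGraph_edgeConfig_adj_iff]
      exact hbc.2.2

/-- **Bridge to the crossing event**: `edgeConfig U ∈ 𝓒(m, n)` iff some vertex of the left side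
is joined inside the box to some vertex of the right side. -/
theorem edgeConfig_mem_crossing_iff (U : Set (Site 2 × Fin 2)) (m n : ℕ) :
    edgeConfig U ∈ KST2023.crossing m n ↔
      U ∈ joined⟪KST2023.box m n, {x | x ∈ KST2023.box m n ∧ x 0 = -(m : ℤ)},
        {x | x ∈ KST2023.box m n ∧ x 0 = m}⟫ := by
  rw [KST2023.mem_crossing]
  constructor
  · rintro ⟨x, hx, y, hy, h⟩
    exact ⟨x, hx, y, hy, ((edgeConfig_mem_openConnIn_iff U _ x y).1 h).2.2⟩
  · rintro ⟨x, hx, y, hy, h⟩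
    exact ⟨x, hx, y, hy, (edgeConfig_mem_openConnIn_iff U _ x y).2 ⟨hx.1, hy.1, h⟩⟩


/-- **Bridge for side events**: `edgeConfig U ∈ openCrossing B L' {v}` iff `v` is joined inside `B`
to the side `L' ⊆ B` (for `v ∈ B`). -/
theorem edgeConfig_mem_openCrossing_singleton_iff (U : Set (Site 2 × Fin 2)) {B L' : Set (Site 2)}
    (hL : L' ⊆ B) {v : Site 2} (hv : v ∈ B) :
    edgeConfig U ∈ openCrossing B L' {v} ↔ v ∈ side⟪B, U, L'⟫ := by
  rw [mem_openCrossing_iff]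
  constructor
  · rintro ⟨x, hx, y, hy, h⟩
    rw [Set.mem_singleton_iff] at hy
    subst hy
    exact ⟨x, hx, ((edgeConfig_mem_openConnIn_iff U B x y).1 h).2.2⟩
  · rintro ⟨x, hx, h⟩
    exact ⟨x, hx, v, Set.mem_singleton v, (edgeConfig_mem_openConnIn_iff U B x v).2 ⟨hL hx, hv, h⟩⟩

/-- **Labels inside a side never matter.** If every label of `A` has both ends in `L`, then
`V ∪ A` joins `L` to `R` iff `V` does (a path may be started at its last visit to `L`). -/
theorem joined_union_iff_of_ends_mem {B : Set (Site 2)} {V A : Set (Site 2 × Fin 2)} {L R : Set (Site 2)}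
    (hA : ∀ ℓ ∈ A, ℓ.1 ∈ L ∧ ℓ.1 + Pi.single ℓ.2 1 ∈ L) :
    V ∪ A ∈ joined⟪B, L, R⟫ ↔ V ∈ joined⟪B, L, R⟫ := by
  refine ⟨?_, joined_mono Set.subset_union_left⟩
  rintro ⟨a, ha, r, hr, har⟩
  suffices key : ∀ y, y ∈ clus⟪B, V ∪ A, a⟫ → ∃ a' ∈ L, y ∈ clus⟪B, V, a'⟫ by
    obtain ⟨a', ha', h⟩ := key r har
    exact ⟨a', ha', r, hr, h⟩
  intro y hy
  induction hy with
  | refl => exact ⟨a, ha, mem_clus_self _⟩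
  | tail _ hyz ih =>
    obtain ⟨a', ha', hy'⟩ := ih
    rcases nbr_union_iff.1 hyz with hyz | hyz
    · exact ⟨a', ha', clus_step hy' hyz⟩
    · obtain ⟨-, -, d₀, ⟨h1, h2⟩ | ⟨h1, h2⟩⟩ := hyz
      · exact ⟨_, (h1 ▸ (hA _ h2).2), mem_clus_self _⟩
      · exact ⟨_, (hA _ h2).1, mem_clus_self _⟩

end Cone3

/-- **Registered sub-goal `stub_cone3_graphB` of stub `stub_cone3`**: the bridge between the tree's
crossing event `KST2023.crossing m k` of a label configuration `edgeConfig U` and the label-level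
connectivity inside the box (`Cone3.edgeConfig_mem_crossing_iff`), written without notations. -/
theorem stub_cone3_graphB : ∀ (U : Set (Site 2 × Fin 2)) (m k : ℕ), edgeConfig U ∈ KST2023.crossing m k ↔ ∃ a ∈ {x : Site 2 | x ∈ KST2023.box m k ∧ x 0 = -(m : ℤ)}, ∃ c ∈ {x : Site 2 | x ∈ KST2023.box m k ∧ x 0 = (m : ℤ)}, Relation.ReflTransGen (fun p q : Site 2 => p ∈ KST2023.box m k ∧ q ∈ KST2023.box m k ∧ ∃ e : Fin 2, (q = p + Pi.single e 1 ∧ (p, e) ∈ U) ∨ (p = q + Pi.single e 1 ∧ (q, e) ∈ U)) a c :=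
  fun U m k => Cone3.edgeConfig_mem_crossing_iff U m k

end Summit.CriticalPhenomena.CardyFormulaZ2.Cruxes.CriticalPathRSW.FiniteSizeEnvelope

end
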